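/-
Copyright (c) 2026. All rights reserved.
Released under Apache 2.0 license as described in the file LICENSE.
Authors: HodgeCM publication cell (pub-hodgecm), GR lane, seat GR-2 (`pub-hodgecm-own-hyp34`).
-/
import Literature.NumberTheory.Automorphic.UnitaryGroupSymplecticEmbedding
import Literature.RepresentationTheory.HeisenbergGroup.SymplecticMatrixTransport
import HarnessLib

/-!
# Split quadratic coordinates: `U(h)(S) ⊂ Sp(Res Sⁿ)` is conjugate to the Siegel LEVI when `d` is a square
# ([MoeglinVignerasWaldspurger1987, Chap. 1 I.17–I.19, Chap. 2 III.1] type II dual pairs; [Kudla1994, §3];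
# [GelbartRogawski1991, §3.1])

Topic `NumberTheory/Automorphic`; namespace `Literature.NumberTheory.Automorphic.UnitaryGroup` (continues
`UnitaryGroupSymplecticEmbedding`).  PURE ALGEBRA over commutative rings; definitions with bodies and proved
theorems only; no named fact, no `sorry`.

SETTING.  Quadratic coordinates `h : IsQuadraticCoordinates φ Ψ δ d` (`S = φ(R) ⊕ φ(R) δ`, `δ² = φ d`,
`QuadraticRestrictionOfScalars`), the conjugation `σ` (`σ ∘ φ = φ`, `σ δ = -δ`), a symmetric `T ∈ Mₙ(R)` with
`IsUnit T.det` and the hermitian matrix `H = T.map φ`, as in `UnitaryGroupSymplecticEmbedding`, whose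
`toSymplectic : U(σ, H) →* Sp(Rⁿ × Rⁿ, polar β_T)` realises the unitary group inside the symplectic group of
`(Res_{S/R} Sⁿ, im h)` in the `R`-rational polarisation `X ⊕ Y = Rⁿ·1 ⊕ Rⁿ·δ`.  THIS FILE treats the SPLIT case:
`d = s²` for some `s ∈ R` with `2s` a unit (witness `e`, `2 s e = 1`) — the situation of `E ⊗_F F_v` at a place `v` of
`F` that splits in the quadratic extension `E` (finite or real), and of `E ⊗_F F_v = ℂ × ℂ` at a complex place.
Then `S ≅ R × R` by the two evaluations `z = a + b δ ↦ a ± s b`, and: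

* §1 **`evalPlus`, `evalMinus : S →+* R`** (`a + bδ ↦ a + s b`, `a - s b`), ring homomorphisms with
  `evalPlus ∘ φ = id`, `evalPlus δ = s`, `evalPlus ∘ σ = evalMinus`; entrywise on matrices **`plusGL`,
  `minusGL : GLₙ(S) →* GLₙ(R)`**, `g ↦ g₊ := g.map evalPlus`, `g₋`.
* §2 for `g ∈ U(σ, H)`: **`g₋ = T⁻¹ (g₊⁻¹)ᵀ T`** (`coe_minusGL_eq_of_mem`) — apply `evalPlus` to `(σg)ᵀ H g = H`.
* §3 the **split Cayley element** `splitCayley ∈ Sp(Rⁿ × Rⁿ, polar β_T)`,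
  `(a, b) ↦ (a + s b, e (s b - a))`, inverse `(u, v) ↦ (s (e u - v), e u + v)`: a symplectic automorphism carrying the
  EIGENSPACE polarisation `{b = e·(2e)⁻¹…}` — precisely the two `S`-submodules `e_± Sⁿ` of the idempotents
  `e_± = ½(1 ± δ/s)`, read in the coordinates `(a, b)` as the graphs `a = ± s b` — onto the standard one `X ⊕ Y`.
* §4 **THE CONJUGATION FORMULA** (`splitCayley_conj_toSymplectic`):
  `splitCayley · toSymplectic g · splitCayley⁻¹ = m(g₊) := leviSp β_T (x ↦ g₊ x) (y ↦ T⁻¹ g₊⁻ᵀ T y)`, the Siegel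
  LEVI element of `SymplecticMatrixTransport` (`= transportSp T (levi g₊)`, `transportSp_levi`); without the unitarity
  hypothesis the conjugate is the block-diagonal `(u, v) ↦ (g₊ u, g₋ v)` (`splitCayley_conj_resAut_apply`).

So at a split place the unitary group is (conjugate to a subgroup of) the Levi factor `GL(X)` of the Siegel
parabolic `P_Y`, the polarisation-preserving subgroup over which the metaplectic cover carries Weil's canonical
lift `𝐫₀` — the input shape of `Weil1964/AdelicSiegelParabolicLiftConj` (sections over conjugates of `P_Y`).  This is
the linear algebra of a type II pair `(GL(X₁), GL(X₂))`, `W = X₁ ⊗ X₂ ⊕ (X₁ ⊗ X₂)^*` [MoeglinVignerasWaldspurger1987,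
Chap. 2 III.1], in coordinates; the finite-place version phrased with the idempotent `e_w ∈ E ⊗ F_v` and a stable
Lagrangian is GR-1's `GelbartRogawski1991/LocalUnitarySplitPlace{Lagrangian,Darboux}`; the present ring-generic form
also serves the archimedean split places and the complex places (`isQuadraticCoordinates_infLocal`).

## References
* [MoeglinVignerasWaldspurger1987] C. Mœglin, M.-F. Vignéras, J.-L. Waldspurger, *Correspondances de Howe sur un corps
  p-adique*, LNM 1291 (1987), Chap. 1 I.17–I.19 (unitary groups in symplectic groups), Chap. 2 III.1 (type II pairs).
* [Kudla1994] S. S. Kudla, *Splitting metaplectic covers of dual reductive pairs*, Israel J. Math. 87 (1994) 361–401,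
  §3 (the split case `E = F ⊕ F`, `U(V) ≅ GL_n(F)` a Siegel Levi).
* [GelbartRogawski1991] S. Gelbart, J. Rogawski, Invent. Math. 105 (1991), §3.1 p. 454 (`W = Res_{E/F} V`,
  `G = U(V) ⊂ Sp(W)`).
-/

set_option autoImplicit false

noncomputable section

open Matrix
open Literature.RepresentationTheory.HeisenbergGroup
open Literature.RepresentationTheory.HeisenbergGroup.SymplecticMatrix

namespace Literature.NumberTheory.Automorphic

namespace UnitaryGroup

namespace IsQuadraticCoordinates

open QuadraticCoordinates

variable {R S : Type*} [CommRing R] [CommRing S]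
variable {φ : R →+* S} {Ψ : (R × R) ≃+ S} {δ : S} {d : R} (h : IsQuadraticCoordinates φ Ψ δ d)
variable {s : R} (hs : s * s = d)

/-! ## §1 The two evaluations `S → R` of a split quadratic algebra -/

section Eval

include h hs

/-- **`evalPlus : S →+* R`, `a + b δ ↦ a + s b`** (evaluation at the root `δ = s` of `δ² = d = s²`).
[cite: MoeglinVignerasWaldspurger1987, Chap. 2 III.1] -/
def evalPlus : S →+* R where
  toFun z := re Ψ z + s * im Ψ z
  map_one' := by rw [h.re_one, h.im_one, mul_zero, add_zero]
  map_mul' x y := by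
    rw [h.re_mul, h.im_mul, ← hs]
    ring
  map_zero' := by rw [map_zero, map_zero, mul_zero, add_zero]
  map_add' x y := by
    rw [map_add, map_add]
    ring

/-- **`evalMinus : S →+* R`, `a + b δ ↦ a - s b`** (evaluation at the other root `δ = -s`).
[cite: MoeglinVignerasWaldspurger1987, Chap. 2 III.1] -/
def evalMinus : S →+* R where
  toFun z := re Ψ z - s * im Ψ z
  map_one' := by rw [h.re_one, h.im_one, mul_zero, sub_zero]
  map_mul' x y := by
    rw [h.re_mul, h.im_mul, ← hs]
    ring
  map_zero' := by rw [map_zero, map_zero, mul_zero, sub_zero]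
  map_add' x y := by
    rw [map_add, map_add]
    ring

/-- formula. [cite: MoeglinVignerasWaldspurger1987, Chap. 2 III.1] -/
theorem evalPlus_apply (z : S) : h.evalPlus hs z = re Ψ z + s * im Ψ z := rfl

/-- formula. [cite: MoeglinVignerasWaldspurger1987, Chap. 2 III.1] -/
theorem evalMinus_apply (z : S) : h.evalMinus hs z = re Ψ z - s * im Ψ z := rfl

/-- `evalPlus (φ a) = a`. [cite: MoeglinVignerasWaldspurger1987, Chap. 2 III.1] -/
@[simp] theorem evalPlus_map (a : R) : h.evalPlus hs (φ a) = a := by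
  rw [evalPlus_apply, h.re_map, h.im_map, mul_zero, add_zero]

/-- `evalMinus (φ a) = a`. [cite: MoeglinVignerasWaldspurger1987, Chap. 2 III.1] -/
@[simp] theorem evalMinus_map (a : R) : h.evalMinus hs (φ a) = a := by
  rw [evalMinus_apply, h.re_map, h.im_map, mul_zero, sub_zero]

/-- `evalPlus δ = s`. [cite: MoeglinVignerasWaldspurger1987, Chap. 2 III.1] -/
@[simp] theorem evalPlus_delta : h.evalPlus hs δ = s := by
  rw [evalPlus_apply, h.re_delta, h.im_delta, mul_one, zero_add]

/-- `evalMinus δ = -s`. [cite: MoeglinVignerasWaldspurger1987, Chap. 2 III.1] -/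
@[simp] theorem evalMinus_delta : h.evalMinus hs δ = -s := by
  rw [evalMinus_apply, h.re_delta, h.im_delta, mul_one, zero_sub]

/-- **the conjugation swaps the two evaluations**: `evalPlus (σ z) = evalMinus z`.
[cite: MoeglinVignerasWaldspurger1987, Chap. 2 III.1] -/
theorem evalPlus_conj {σ : S →+* S} (hσφ : ∀ a, σ (φ a) = φ a) (hσδ : σ δ = -δ) (z : S) :
    h.evalPlus hs (σ z) = h.evalMinus hs z := by
  rw [evalPlus_apply, evalMinus_apply, h.re_conj hσφ hσδ, h.im_conj hσφ hσδ, mul_neg, sub_eq_add_neg]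

/-- `evalMinus (σ z) = evalPlus z`. [cite: MoeglinVignerasWaldspurger1987, Chap. 2 III.1] -/
theorem evalMinus_conj {σ : S →+* S} (hσφ : ∀ a, σ (φ a) = φ a) (hσδ : σ δ = -δ) (z : S) :
    h.evalMinus hs (σ z) = h.evalPlus hs z := by
  rw [evalPlus_apply, evalMinus_apply, h.re_conj hσφ hσδ, h.im_conj hσφ hσδ, mul_neg, sub_neg_eq_add]

/-- `evalPlus ∘ φ = id`. [cite: MoeglinVignerasWaldspurger1987, Chap. 2 III.1] -/
theorem evalPlus_comp_map : (h.evalPlus hs).comp φ = RingHom.id R :=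
  RingHom.ext fun a => h.evalPlus_map hs a

/-- `evalMinus ∘ φ = id`. [cite: MoeglinVignerasWaldspurger1987, Chap. 2 III.1] -/
theorem evalMinus_comp_map : (h.evalMinus hs).comp φ = RingHom.id R :=
  RingHom.ext fun a => h.evalMinus_map hs a

variable (n : Type*) [Fintype n] [DecidableEq n]

/-- **`g ↦ g₊ := g.map evalPlus : GLₙ(S) →* GLₙ(R)`**. [cite: Kudla1994, §3] -/
def plusGL : GL n S →* GL n R := Units.map (h.evalPlus hs).mapMatrix.toMonoidHom

/-- **`g ↦ g₋ := g.map evalMinus : GLₙ(S) →* GLₙ(R)`**. [cite: Kudla1994, §3] -/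
def minusGL : GL n S →* GL n R := Units.map (h.evalMinus hs).mapMatrix.toMonoidHom

/-- underlying matrix of `g₊`. [cite: Kudla1994, §3] -/
@[simp] theorem coe_plusGL (g : GL n S) :
    ((h.plusGL hs n g : GL n R) : Matrix n n R) = (g : Matrix n n S).map (h.evalPlus hs) := rfl

/-- underlying matrix of `g₋`. [cite: Kudla1994, §3] -/
@[simp] theorem coe_minusGL (g : GL n S) :
    ((h.minusGL hs n g : GL n R) : Matrix n n R) = (g : Matrix n n S).map (h.evalMinus hs) := rfl

omit [Fintype n] [DecidableEq n] in
/-- `g₊ = g₁ + s g₂` for `g = g₁ + g₂ δ` (`g₁ = re ∘ g`, `g₂ = im ∘ g` entrywise). [cite: Kudla1994, §3] -/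
theorem map_evalPlus_eq (G : Matrix n n S) : G.map (h.evalPlus hs) = G.map (re Ψ) + s • G.map (im Ψ) := by
  ext i j
  rfl

omit [Fintype n] [DecidableEq n] in
/-- `g₋ = g₁ - s g₂`. [cite: Kudla1994, §3] -/
theorem map_evalMinus_eq (G : Matrix n n S) : G.map (h.evalMinus hs) = G.map (re Ψ) - s • G.map (im Ψ) := by
  ext i j
  rfl

/-- on `GLₙ(R) ≤ GLₙ(S)` (entries in `φ(R)`): `(a ⊗ 1)₊ = a`. [cite: Kudla1994, §3] -/
theorem plusGL_map (a : GL n R) : h.plusGL hs n (Matrix.GeneralLinearGroup.map φ a) = a := by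
  refine Units.ext (Matrix.ext fun i j => ?_)
  exact h.evalPlus_map hs _

/-- `(a ⊗ 1)₋ = a`. [cite: Kudla1994, §3] -/
theorem minusGL_map (a : GL n R) : h.minusGL hs n (Matrix.GeneralLinearGroup.map φ a) = a := by
  refine Units.ext (Matrix.ext fun i j => ?_)
  exact h.evalMinus_map hs _

end Eval

/-! ## §2 Unitarity read through the evaluations: `g₋ = T⁻¹ (g₊⁻¹)ᵀ T` -/

section Unitary

variable (n : Type*) [Fintype n] [DecidableEq n]
variable {T : Matrix n n R}
variable {σ : S →+* S} (hσφ : ∀ a, σ (φ a) = φ a) (hσδ : σ δ = -δ) {H : Matrix n n S} (hH : H = T.map φ)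

include h hs hσφ hσδ hH in
/-- **unitarity on the `+` side**: for `g ∈ U(σ, H)`, `H = T ⊗ 1`: `g₋ᵀ T g₊ = T` (apply `evalPlus` entrywise to
`(σ g)ᵀ H g = H`; `evalPlus ∘ σ = evalMinus`, `evalPlus ∘ φ = id`). [cite: Kudla1994, §3] -/
theorem minus_transpose_mul_mul_plus {g : GL n S} (hg : g ∈ unitaryGroupOfForm σ H) :
    ((g : Matrix n n S).map (h.evalMinus hs))ᵀ * T * (g : Matrix n n S).map (h.evalPlus hs) = T := by
  rw [mem_unitaryGroupOfForm_iff, hH] at hg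
  have h1 := congrArg (fun M : Matrix n n S => M.map (h.evalPlus hs)) hg
  simp only [Matrix.map_mul, Matrix.map_map] at h1
  have hTmap : (T.map (⇑(h.evalPlus hs) ∘ ⇑φ)) = T := by
    ext i j
    exact h.evalPlus_map hs _
  have hσmap : ((g : Matrix n n S).map σ)ᵀ.map (h.evalPlus hs) = ((g : Matrix n n S).map (h.evalMinus hs))ᵀ := by
    ext i j
    simp only [Matrix.map_apply, Matrix.transpose_apply, h.evalPlus_conj hs hσφ hσδ]
  rw [hTmap] at h1
  rwa [← Matrix.transpose_map, Matrix.map_map, show (⇑(h.evalPlus hs) ∘ ⇑σ) = ⇑(h.evalMinus hs) from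
    funext fun z => h.evalPlus_conj hs hσφ hσδ z] at h1

include h hs hσφ hσδ hH in
/-- **`g₋ = T⁻¹ (g₊⁻¹)ᵀ T`** for `g ∈ U(σ, H)` (`T` symmetric with `IsUnit T.det`): the `−`-evaluation of a unitary
matrix is the contragredient of its `+`-evaluation read through the duality `β_T` — i.e. `(g₊, g₋)` is the Siegel
Levi pair `(a, T⁻¹ a⁻ᵀ T)` of `SymplecticMatrixTransport.leviDual`. [cite: Kudla1994, §3] -/
theorem coe_minusGL_eq_of_mem (hT : T.IsSymm) (hTd : IsUnit T.det) {g : GL n S} (hg : g ∈ unitaryGroupOfForm σ H) :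
    ((h.minusGL hs n g : GL n R) : Matrix n n R) =
      T⁻¹ * (((h.plusGL hs n g)⁻¹ : GL n R) : Matrix n n R)ᵀ * T := by
  have key := h.minus_transpose_mul_mul_plus hs n hσφ hσδ hH hg
  have hplus : (g : Matrix n n S).map (h.evalPlus hs) * (((h.plusGL hs n g)⁻¹ : GL n R) : Matrix n n R) = 1 := by
    rw [← coe_plusGL, ← Units.val_mul, mul_inv_cancel, Units.val_one]
  -- `g₋ᵀ = T g₊⁻¹ T⁻¹`
  have h2 : ((g : Matrix n n S).map (h.evalMinus hs))ᵀ =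
      T * (((h.plusGL hs n g)⁻¹ : GL n R) : Matrix n n R) * T⁻¹ := by
    calc ((g : Matrix n n S).map (h.evalMinus hs))ᵀ
        = ((g : Matrix n n S).map (h.evalMinus hs))ᵀ * T *
            ((g : Matrix n n S).map (h.evalPlus hs) * (((h.plusGL hs n g)⁻¹ : GL n R) : Matrix n n R)) * T⁻¹ := by
          rw [hplus, Matrix.mul_one, Matrix.mul_assoc, Matrix.mul_nonsing_inv T hTd, Matrix.mul_one]
      _ = ((g : Matrix n n S).map (h.evalMinus hs))ᵀ * T * (g : Matrix n n S).map (h.evalPlus hs) *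
            (((h.plusGL hs n g)⁻¹ : GL n R) : Matrix n n R) * T⁻¹ := by
          simp only [Matrix.mul_assoc]
      _ = T * (((h.plusGL hs n g)⁻¹ : GL n R) : Matrix n n R) * T⁻¹ := by rw [key]
  rw [coe_minusGL, ← Matrix.transpose_transpose ((g : Matrix n n S).map (h.evalMinus hs)), h2,
    Matrix.transpose_mul, Matrix.transpose_mul, Matrix.transpose_nonsing_inv, hT.eq]
  simp only [Matrix.mul_assoc]

end Unitary

/-! ## §3 The split Cayley element `(a, b) ↦ (a + s b, e (s b - a))` of `Sp(Rⁿ × Rⁿ, polar β_T)` -/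

section Cayley

variable (n : Type*) [Fintype n] [DecidableEq n]
variable (T : Matrix n n R) {e : R} (he : 2 * s * e = 1)

/-- the split Cayley map as a linear automorphism of `Rⁿ × Rⁿ`: `(a, b) ↦ (a + s b, e (s b - a))`, inverse
`(u, v) ↦ (s (e u - v), e u + v)`. [cite: MoeglinVignerasWaldspurger1987, Chap. 2 III.1] -/
def splitCayleyEquiv : ((n → R) × (n → R)) ≃ₗ[R] ((n → R) × (n → R)) where
  toFun p := (p.1 + s • p.2, e • (s • p.2 - p.1))
  invFun q := (s • (e • q.1 - q.2), e • q.1 + q.2)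
  map_add' p q := by
    ext i <;> simp only [Prod.fst_add, Prod.snd_add, Pi.add_apply, Pi.smul_apply, Pi.sub_apply, smul_eq_mul] <;> ring
  map_smul' c p := by
    ext i <;> simp only [Prod.smul_fst, Prod.smul_snd, Pi.add_apply, Pi.smul_apply, Pi.sub_apply, smul_eq_mul,
      RingHom.id_apply] <;> ring
  left_inv p := by
    ext i
    · simp only [Pi.add_apply, Pi.smul_apply, Pi.sub_apply, smul_eq_mul]
      linear_combination (p.1 i) * he
    · simp only [Pi.add_apply, Pi.smul_apply, Pi.sub_apply, smul_eq_mul]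
      linear_combination (p.2 i) * he
  right_inv q := by
    ext i
    · simp only [Pi.add_apply, Pi.smul_apply, Pi.sub_apply, smul_eq_mul]
      linear_combination (q.1 i) * he
    · simp only [Pi.add_apply, Pi.smul_apply, Pi.sub_apply, smul_eq_mul]
      linear_combination (q.2 i) * he

omit [Fintype n] [DecidableEq n] in
/-- formula. [cite: MoeglinVignerasWaldspurger1987, Chap. 2 III.1] -/
@[simp] theorem splitCayleyEquiv_apply (p : (n → R) × (n → R)) :
    splitCayleyEquiv n he p = (p.1 + s • p.2, e • (s • p.2 - p.1)) := rfl

omit [Fintype n] [DecidableEq n] in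
/-- inverse formula. [cite: MoeglinVignerasWaldspurger1987, Chap. 2 III.1] -/
@[simp] theorem splitCayleyEquiv_symm_apply (q : (n → R) × (n → R)) :
    (splitCayleyEquiv n he).symm q = (s • (e • q.1 - q.2), e • q.1 + q.2) := rfl

omit h in
omit [DecidableEq n] in
/-- `β_T` is symmetric: `x ⬝ᵥ T y = y ⬝ᵥ T x`. [folklore] -/
private theorem dot_mulVec_comm (hT : T.IsSymm) (x y : n → R) : x ⬝ᵥ (T *ᵥ y) = y ⬝ᵥ (T *ᵥ x) := by
  rw [Matrix.dotProduct_mulVec, ← Matrix.mulVec_transpose, hT.eq, dotProduct_comm]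

include he in
/-- **the split Cayley map is symplectic** for `alt (polar β_T)`: `⟪c p, c q⟫ = ⟪p, q⟫`.
[cite: MoeglinVignerasWaldspurger1987, Chap. 2 III.1] -/
theorem splitCayleyEquiv_mem_symplecticGroup (hT : T.IsSymm) :
    splitCayleyEquiv n he ∈ symplecticGroup (polar (Matrix.toLinearMap₂' R T)) := by
  rw [mem_symplecticGroup]
  intro p q
  simp only [polar_apply, splitCayleyEquiv_apply, Matrix.toLinearMap₂'_apply', Matrix.mulVec_smul,
    Matrix.mulVec_sub, dotProduct_sub, dotProduct_smul, add_dotProduct, smul_dotProduct, smul_eq_mul]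
  have hA := dot_mulVec_comm n T hT q.1 p.1
  have hB := dot_mulVec_comm n T hT q.2 p.2
  have hC := dot_mulVec_comm n T hT q.2 p.1
  have hD := dot_mulVec_comm n T hT p.2 q.1
  linear_combination e * hA + (-(e * s * s)) * hB + (e * s) * hC + (-(e * s)) * hD +
    (p.1 ⬝ᵥ (T *ᵥ q.2) - q.1 ⬝ᵥ (T *ᵥ p.2)) * he

/-- **`splitCayley ∈ Sp(Rⁿ × Rⁿ, polar β_T)`**: the split Cayley element.
[cite: MoeglinVignerasWaldspurger1987, Chap. 2 III.1] -/
def splitCayley (hT : T.IsSymm) : symplecticGroup (polar (Matrix.toLinearMap₂' R T)) :=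
  ⟨splitCayleyEquiv n he, splitCayleyEquiv_mem_symplecticGroup n T he hT⟩

/-- underlying automorphism. [cite: MoeglinVignerasWaldspurger1987, Chap. 2 III.1] -/
@[simp] theorem coe_splitCayley (hT : T.IsSymm) :
    ((splitCayley n T he hT : symplecticGroup (polar (Matrix.toLinearMap₂' R T))) :
      ((n → R) × (n → R)) ≃ₗ[R] ((n → R) × (n → R))) = splitCayleyEquiv n he := rfl

omit [Fintype n] [DecidableEq n] in
/-- `splitCayley` carries the `+`-eigenspace `{(s b', b')}` (`= e_+ Sⁿ` in the coordinates `reIm`) onto `X = Rⁿ × 0`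
and the `−`-eigenspace `{(-s b', b')}` onto `Y = 0 × Rⁿ`. [cite: MoeglinVignerasWaldspurger1987, Chap. 2 III.1] -/
theorem splitCayleyEquiv_apply_eigen (b' : n → R) :
    splitCayleyEquiv n he (s • b', b') = ((2 * s) • b', 0) ∧
      splitCayleyEquiv n he (-(s • b'), b') = (0, (2 * e * s) • b') := by
  refine ⟨Prod.ext (funext fun i => ?_) (funext fun i => ?_), Prod.ext (funext fun i => ?_) (funext fun i => ?_)⟩ <;>
    simp only [splitCayleyEquiv_apply, Pi.add_apply, Pi.smul_apply, Pi.sub_apply, Pi.neg_apply, Pi.zero_apply,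
      smul_eq_mul] <;> ring

end Cayley

/-! ## §4 The conjugation formula: `splitCayley · U(σ, H) · splitCayley⁻¹ ⊆ M_Y` (the Siegel Levi) -/

section Conj

variable (n : Type*) [Fintype n] [DecidableEq n]
variable {T : Matrix n n R} (hTd : IsUnit T.det) {e : R} (he : 2 * s * e = 1)
variable {σ : S →+* S} (hσφ : ∀ a, σ (φ a) = φ a) (hσδ : σ δ = -δ) {H : Matrix n n S} (hH : H = T.map φ)

include h hs he in
/-- **block-diagonalisation of the restriction-of-scalars action**: for EVERY `g ∈ GLₙ(S)`,
`splitCayley ∘ resAut g ∘ splitCayley⁻¹ : (u, v) ↦ (g₊ u, g₋ v)`. [cite: Kudla1994, §3] -/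
theorem splitCayley_conj_resAut_apply (g : GL n S) (q : (n → R) × (n → R)) :
    splitCayleyEquiv n he (h.resAut n g ((splitCayleyEquiv n he).symm q)) =
      (((h.plusGL hs n g : GL n R) : Matrix n n R) *ᵥ q.1, ((h.minusGL hs n g : GL n R) : Matrix n n R) *ᵥ q.2) := by
  subst hs
  rw [splitCayleyEquiv_symm_apply, h.resAut_apply_mk, splitCayleyEquiv_apply, coe_plusGL, coe_minusGL,
    map_evalPlus_eq, map_evalMinus_eq]
  refine Prod.ext (funext fun i => ?_) (funext fun i => ?_)
  · simp only [Pi.add_apply, Pi.smul_apply, Pi.sub_apply, smul_eq_mul, Matrix.add_mulVec, Matrix.smul_mulVec,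
      Matrix.mulVec_add, Matrix.mulVec_sub, Matrix.mulVec_smul]
    linear_combination (((g : Matrix n n S).map (re Ψ) *ᵥ q.1) i + s * (((g : Matrix n n S).map (im Ψ) *ᵥ q.1) i)) * he
  · simp only [Pi.add_apply, Pi.smul_apply, Pi.sub_apply, smul_eq_mul, Matrix.sub_mulVec, Matrix.smul_mulVec,
      Matrix.mulVec_add, Matrix.mulVec_sub, Matrix.mulVec_smul]
    linear_combination (((g : Matrix n n S).map (re Ψ) *ᵥ q.2) i - s * (((g : Matrix n n S).map (im Ψ) *ᵥ q.2) i)) * he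

include h hs hTd he hσφ hσδ hH in
/-- **THE CONJUGATION FORMULA**: for `g ∈ U(σ, H)`, `H = T ⊗ 1` (`T` symmetric, `IsUnit T.det`), `d = s²`, `2 s e = 1`:
`splitCayley · toSymplectic g · splitCayley⁻¹ = leviSp β_T (x ↦ g₊ x) (y ↦ T⁻¹ g₊⁻ᵀ T y)` — the image of the unitary
group under `toSymplectic` is conjugate INTO THE SIEGEL LEVI `M_Y ≅ GL(X)`, `g ↦ m(g₊)`. [cite: Kudla1994, §3] -/
theorem splitCayley_conj_toSymplectic (hT : T.IsSymm) (g : unitaryGroupOfForm σ H) :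
    splitCayley n T he hT * h.toSymplectic n hT hσφ hσδ hH g * (splitCayley n T he hT)⁻¹ =
      leviSp (Matrix.toLinearMap₂' R T) (glEquiv (h.plusGL hs n g)) (leviDual T hTd (h.plusGL hs n g))
        (leviDual_compat T hTd (h.plusGL hs n g)) := by
  apply Subtype.ext
  apply LinearEquiv.ext
  intro q
  rw [Subgroup.coe_mul, Subgroup.coe_mul, Subgroup.coe_inv, LinearEquiv.mul_apply, LinearEquiv.mul_apply,
    LinearEquiv.coe_inv, coe_splitCayley, coe_toSymplectic, coe_leviSp_apply, glEquiv_apply, leviDual_apply,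
    h.splitCayley_conj_resAut_apply hs n he, ← h.coe_minusGL_eq_of_mem hs n hσφ hσδ hH hT hTd g.2]

include h hs hTd he hσφ hσδ hH in
/-- the same with the matrix Levi element: `splitCayley · toSymplectic g · splitCayley⁻¹ = transportSp T (levi g₊)`.
[cite: Kudla1994, §3] -/
theorem splitCayley_conj_toSymplectic_eq_transportSp_levi (hT : T.IsSymm) (g : unitaryGroupOfForm σ H) :
    splitCayley n T he hT * h.toSymplectic n hT hσφ hσδ hH g * (splitCayley n T he hT)⁻¹ =
      transportSp T hTd (levi (h.plusGL hs n g)) := by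
  rw [transportSp_levi, h.splitCayley_conj_toSymplectic hs n hTd he hσφ hσδ hH hT]

include h hs hTd he hσφ hσδ hH in
/-- as homomorphisms: `conj(splitCayley) ∘ toSymplectic = transportSp T ∘ levi ∘ plusGL` on `U(σ, H)`.
[cite: Kudla1994, §3] -/
theorem conj_splitCayley_comp_toSymplectic (hT : T.IsSymm) :
    (MulAut.conj (splitCayley n T he hT)).toMonoidHom.comp (h.toSymplectic n hT hσφ hσδ hH) =
      (transportSp T hTd).comp (leviHom.comp ((h.plusGL hs n).comp (unitaryGroupOfForm σ H).subtype)) := by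
  ext g : 1
  simp only [MonoidHom.comp_apply, MulEquiv.coe_toMonoidHom, MulAut.conj_apply, Subgroup.coe_subtype,
    leviHom_apply]
  exact h.splitCayley_conj_toSymplectic_eq_transportSp_levi hs n hTd he hσφ hσδ hH hT g

include h hs hTd he hσφ hσδ hH in
/-- **the conjugated unitary group preserves the standard Lagrangian `Y = 0 × Rⁿ`** (and `X`): the form in which
`Weil1964.AdelicSiegelParabolicLiftConj` consumes it (`g⁻¹ j(x) g ∈ P_Y` with `g = splitCayley⁻¹`).
[cite: Kudla1994, §3] -/
theorem splitCayley_conj_toSymplectic_apply_inr (hT : T.IsSymm) (g : unitaryGroupOfForm σ H) (y : n → R) :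
    (((splitCayley n T he hT * h.toSymplectic n hT hσφ hσδ hH g * (splitCayley n T he hT)⁻¹ :
        symplecticGroup (polar (Matrix.toLinearMap₂' R T))) : ((n → R) × (n → R)) ≃ₗ[R] ((n → R) × (n → R)))
      (0, y)).1 = 0 := by
  rw [h.splitCayley_conj_toSymplectic hs n hTd he hσφ hσδ hH hT g, coe_leviSp_apply, glEquiv_apply, Matrix.mulVec_zero]

end Conj

end IsQuadraticCoordinates

end UnitaryGroup

end Literature.NumberTheory.Automorphic

end
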